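import Mathlib.Algebra.Group.ForwardDiff
import Mathlib.Analysis.Matrix.Spectrum
import Mathlib.RingTheory.Polynomial.Chebyshev
import Mathlib.Tactic.ComputeDegree
import Literature.MathematicalPhysics.QuantumLattice.GrassmannIntegralWilsonProofs
import Literature.MathematicalPhysics.QuantumFieldTheory.QCDOS
import Literature.MathematicalPhysics.QuantumFieldTheory.QCDPhaseQuenched
import HarnessLib

/-!
# Lüscher's multiboson weight, the bosonised gauge marginal of lattice QCD, and the three
# predicates of the route `MultibosonBridge` (admissible root data, spectral-tail domination,
# bosonised lattice gap)

Definition requests `defn-HasMultibosonLatticeGap`, `defn-IsAdmissibleMultibosonData` and the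
vocabulary of `defn-multibosonExpect` they rest on (topic
`Literature/MathematicalPhysics/QuantumFieldTheory`, next to `QCDOS`; wanted by route
`Summit.QuantumFields.QCD.Theses.MultibosonBridge`, items
`MultibosonLatticeGap` (stmt-QuantumFields-9599) and `GapTransfer` (stmt-QuantumFields-9600), whose
statements inline all of the following as one `let` vocabulary `Dm / W / E / Qm / qv / Adm / Tail /
Gap`). This file names that vocabulary, VERBATIM: `W ↦ multibosonWeight`, `E ↦ multibosonExpect`,
`qv ↦ multibosonModSq`, `Qm ↦ HasSupportedQuasiMode`, `Adm ↦ IsAdmissibleMultibosonData`,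
`Tail ↦ HasSpectralTailDomination`, `Gap ↦ QCDScheme.HasMultibosonLatticeGap` (the `let plc / Ek`
of `Gap` are kept as `let`s inside the body; `dsimp only` removes them).

## Source (Lüscher 1994)

Two degenerate Wilson flavours give the effective gauge distribution
`P_eff[U] = Z⁻¹ [det(D+m)]² e^{−S_g[U]}` (Lüscher, Nucl. Phys. B 418 (1994) 637, (2.4)); since
`[γ₅(D+m)]† = γ₅(D+m)` ((2.6)) the matrix `Q = γ₅(D+m)/M` is Hermitian with real spectrum and
`det(D+m)` is real ((2.7)–(2.8)). For ANY polynomial `P(s) ≈ 1/s` none of whose roots `z_k` is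
real, `det Q² = lim_n [det P(Q²)]⁻¹` ((3.3)) and `P(Q²) = ∏_k ((Q − μ_k)² + ν_k²)`,
`μ_k + iν_k = √z_k` ((3.4)–(3.6)), so that `[det P(Q²)]⁻¹ ∝ ∏_k det((Q − μ_k)² + ν_k²)⁻¹ =
∏_k |det(Q − μ_k − iν_k)|⁻²` is the partition function of `n` complex boson fields `φ_k` with the
LOCAL, NON-NEGATIVE Gaussian action `S_b = S_g + Σ_x Σ_k (|(Q − μ_k)φ_k(x)|² + ν_k²|φ_k(x)|²)`
((3.7)–(3.9)): "the action `S_b[U,φ]` is local and non-negative. In particular, the Gaussian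
integrals in eq. (3.8) are well-defined … One only requires that eq. (3.2) holds and that none of
the roots `z_k` of the polynomial are real" (§3). §4.3 ((4.11)–(4.17)) constructs the Chebyshev
polynomial on `[ε, 1]` with relative error `δ = 2((1−√ε)/(1+√ε))^{n+1}`. The route reads this
constructively: for per-flavour root lists `ν_f` (one root `z` = one boson multiplet, placed
directly on the Hermitian operator `H_f = γ₅ D_W(U, m_f)` rather than on `Q²`) the weight
`W(U) = ∏_f ∏_{z ∈ ν_f} |det(H_f − z)|⁻²` is positive and the Wilson measure reweighted by `W` is an
`SU(3)` lattice gauge–Higgs system; the exact correction factor is handled by the route items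
(`ReweightingIdentity`, `GapTransfer`), not here.

## Contents

* `multibosonWeight S mq l U` (W), `multibosonWeight_nonneg`, `multibosonWeight_inv_pos` /
  `multibosonWeight_pos` (all roots non-real ⇒ `0 < W`, via `det (H − z) ≠ 0` for Hermitian
  `H`, `Im z ≠ 0`: `det_sub_smul_one_ne_zero_of_isHermitian`,
  `isHermitian_gammaFive_mul_wilsonDirac_fundamental`),
  `continuous_multibosonWeight_inv`, `measurable_multibosonWeight`, and for non-real roots
  `continuous_multibosonWeight`, `integrable_multibosonWeight`, `integral_multibosonWeight_pos`,
  `integral_coe_multibosonWeight_ne_zero`;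
* `multibosonExpect S β mq l g` (E^bos, the `W`-reweighted Wilson expectation; junk `0` when the
  normalisation vanishes), `norm_multibosonExpect_le_one` (`‖g‖ ≤ 1 ⇒ ‖E g‖ ≤ 1`, unconditionally),
  `multibosonExpect_const_one` / `multibosonExpect_one` (`E 1 = 1` once `∫ W ≠ 0`, e.g. non-real
  roots);
* `multibosonModSq l t = ∏_{z∈l} |t − z|²` (qv), `HasSupportedQuasiMode U μ η P` (Qm) with `.mono`;
* `IsAdmissibleMultibosonData sch ε δ ℓ ν` (Adm) and `HasSpectralTailDomination sch ε p ℓ ν` (Tail)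
  with their subsequence stability `….comp_strictMono`;
* the MONIC OBSTRUCTION `multibosonModSq_monic_obstruction` (no root list keeps the monic
  `|t| ∏_{z}|t − z|²` below `1 + δ < 2` on `[−c, c]` when `c ≥ 4`: finite differences of a monic
  polynomial) and its corollaries `IsAdmissibleMultibosonData.false`,
  `not_isAdmissibleMultibosonData`: the rev-3 predicate `Adm` above is unsatisfiable for `N_f ≥ 1`
  and is SUPERSEDED by `IsAdmissibleMultibosonDataR` (file `MultibosonAdmissibleData.lean`);
* `QCDScheme.HasMultibosonLatticeGap sch ν Δ` (Gap) with `HasMultibosonLatticeGap.anti` (antitone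
  in `Δ`), `QCDScheme.hasMultibosonLatticeGap_of_nonpos` (every scheme has "gap" `Δ ≤ 0`, constant
  `C = 2`: the content is `Δ > 0`) and `HasMultibosonLatticeGap.comp_strictMono` (stability under
  subsequences of the scheme, stated through the field equations `sch'.a j = sch.a (φ j)`, … exactly
  as route item `DiagonalSpine.SubsequenceStability` produces them).

With these names the route items restate DEFINITIONALLY (checked by `Iff.rfl` in the proposer's
scratch file against the Theses module): `GapTransfer ↔ ∀ Nf sch ε δ p ℓ ν Δ,
IsAdmissibleMultibosonData sch ε δ ℓ ν → HasSpectralTailDomination sch ε p ℓ ν → 0 < Δ →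
sch.HasMultibosonLatticeGap ν Δ → ∃ Δ', 0 < Δ' ∧ Δ' ≤ Δ ∧ sch.HasLatticeMassGap Δ'`, and likewise
`MultibosonLatticeGap` and `ReweightingIdentity` (with `multibosonExpect`, `multibosonWeight`).

## Later revisions of the route (2026-08-15): the rev-3 `Adm` is empty

The rev-3 items `MultibosonLatticeGap` (stmt-QuantumFields-9599) and `AdmissibleRootsExist`
(stmt-9603) were refuted inside the tree: the typed filter `q(t) = ∏_{z ∈ ν} |t − z|²` is MONIC, and
a monic `|t| q(t)` of degree `2|ν| + 1` cannot stay below `1 + δ < 2` on `[−c, c]`, `c ≥ 4` (its top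
finite difference over `2|ν| + 2` equispaced nodes is `(2|ν|+1)! (2c/(2|ν|+1))^{2|ν|+1} > 2^{2|ν|+2}`),
whereas Lüscher's polynomial `P(s) = c_n ∏ₖ (s − z_k) ≈ 1/s` carries a free normalisation `c_n`
(cf. Boriçi–de Forcrand 1995, §2). Hence `IsAdmissibleMultibosonData` is unsatisfiable as soon as
there is one flavour — proved HERE, next to the predicate, as `not_isAdmissibleMultibosonData` (the
argument of the prover file `Summits/QuantumFields/QCD/Theorems/MultibosonBridgeMultibosonLatticeGapRefutation`,
which Literature cannot import). The repaired predicate of the later route revisions (normalisation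
`κ_{k,f} > 0`, degree bound `|ν_{k,f}| ≤ ℓ_k log(2/δ_k)`, scale-free range) is
`IsAdmissibleMultibosonDataR` in `MultibosonAdmissibleData.lean`; `HasSpectralTailDomination` and
`QCDScheme.HasMultibosonLatticeGap` below are unchanged and still the route's `Tail` / `Gap`.

## Design choices / what is NOT here

* Everything is specialised exactly as in the route: gauge group `SU(3)`, fundamental colour
  representation, Wilson parameter `r = 1`, torus of side `2S+1 ≥ 2L_k+1`, Euclidean time =
  coordinate `0`, covariances of bounded measurable CYLINDER gauge functionals of bounded physical
  range (gauge averaging factorises across separated supports, so covariances of all bounded local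
  functionals suffice); the constant `C` of `Gap` may depend on the pair of families.
* `multibosonExpect` is a ratio of Bochner integrals against the tree's `wilsonMeasure`; it is the
  honest normalised expectation whenever `∫ W dμ_W ≠ 0` (e.g. all roots non-real, `W` measurable),
  and the junk value `0/0 = 0` otherwise — documented, never hidden in a hypothesis.
* Continuity of `U ↦ D_W(U)` and the probability-measure instance for the `SU(3)` Wilson measure
  are imported from `QCDPhaseQuenched` (`continuous_wilsonDirac`,
  `isProbabilityMeasure_wilsonMeasure_fundamental`), γ₅-hermiticity from
  `GrassmannIntegralWilsonProofs` (`wilsonDirac_gammaFive_hermitian_holds`).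
* NOT here: Lüscher's Gaussian identity `∫ exp(−‖(H − z)φ‖²) dφ = π^N/|det(H − z)|²` (route item
  `MultibosonGaussian`), the reweighting identity `qcdTorusExpect = E[FI(X·f_B)/W]/E[FI(f_B)/W]`
  (route item `ReweightingIdentity`), the explicit bound `W ≤ ∏_f ∏_z |Im z|^{−2n}`, linearity of
  `E^bos`, existence of admissible root lists (route item `AdmissibleRootsExist`), and any ASSERTION
  of `Tail` or of a positive bosonised gap (route items `MultibosonLatticeGap`, `GapTransfer`).
-/

open scoped Matrix
open MeasureTheory Filter Topology
open Literature.Probability.LatticeModels Literature.MathematicalPhysics.QuantumLattice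

noncomputable section

namespace Literature.MathematicalPhysics.QuantumFieldTheory

local notation "𝔾" => Matrix.specialUnitaryGroup (Fin 3) ℂ

variable {Nf : ℕ}

/-! ### A linear-algebra lemma: Hermitian matrices have no non-real eigenvalues -/

/-- For a Hermitian matrix `H` and `z ∈ ℂ` with `Im z ≠ 0`, `det (H − z·1) ≠ 0` (the spectrum of a
Hermitian matrix is real: `charpoly H = ∏ᵢ (X − λᵢ)` with real `λᵢ`). This is Lüscher's remark that
the multiboson Gaussian integrals are well defined as soon as "none of the roots `z_k` of the
polynomial are real" (Lüscher 1994, §3, after (3.9)). [folklore] -/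
theorem det_sub_smul_one_ne_zero_of_isHermitian {n : Type*} [Fintype n] [DecidableEq n]
    {H : Matrix n n ℂ} (hH : H.IsHermitian) {z : ℂ} (hz : z.im ≠ 0) :
    (H - z • (1 : Matrix n n ℂ)).det ≠ 0 := by
  have h1 : H - z • (1 : Matrix n n ℂ) = -(Matrix.scalar n z - H) := by
    rw [Matrix.scalar_apply, ← Matrix.smul_one_eq_diagonal, neg_sub]
  rw [h1, Matrix.det_neg, ← Matrix.eval_charpoly, hH.charpoly_eq, Polynomial.eval_prod]
  refine mul_ne_zero (pow_ne_zero _ (neg_ne_zero.mpr one_ne_zero)) ?_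
  refine Finset.prod_ne_zero_iff.mpr fun i _ h => hz ?_
  have him := congrArg Complex.im h
  simpa using him

/-! ### The multiboson weight `W` and the bosonised expectation `E^bos` -/

/-- **Lüscher's multiboson (bosonic Gaussian) weight** on gauge fields of the torus of side `S`,
for bare masses `m_f` and per-flavour finite root lists `l_f ⊂ ℂ`:
`W(U) = (∏_f ∏_{z ∈ l_f} |det(γ₅ D_W(U, m_f, 1) − z)|²)⁻¹` (`D_W` the tree's `wilsonDirac` in the
fundamental representation of `SU(3)`, `r = 1`). Each factor `|det(H − z)|⁻²`, `H = γ₅ D_W`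
Hermitian, `z = μ + iν` non-real, is `det((H − μ)² + ν²)⁻¹`, the partition function of one complex
boson multiplet with the local non-negative Gaussian action `|(H − μ)φ|² + ν²|φ|²` (Lüscher (3.5),
(3.7)–(3.9)); VERBATIM the `let W` of route items `MultibosonLatticeGap` / `GapTransfer`. Junk value
`0` (Lean's `0⁻¹`) if some root is an eigenvalue, which `multibosonWeight_pos` excludes for non-real
roots. [cite: Luscher1994, §3 (3.3)–(3.9)] -/
def multibosonWeight (S : ℕ) [NeZero S] (mq : Fin Nf → ℝ) (l : Fin Nf → List ℂ)
    (U : GaugeConfig 4 S 𝔾) : ℝ :=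
  (∏ f, ((l f).map fun z =>
      ‖(spinorLift gammaFive * wilsonDirac (fundamentalRep (Fin 3)) U (mq f) 1 -
        z • 1).det‖ ^ 2).prod)⁻¹

/-- `W ≥ 0` always (an inverse of a product of squares of absolute values). [folklore] -/
theorem multibosonWeight_nonneg (S : ℕ) [NeZero S] (mq : Fin Nf → ℝ) (l : Fin Nf → List ℂ)
    (U : GaugeConfig 4 S 𝔾) : 0 ≤ multibosonWeight S mq l U := by
  unfold multibosonWeight
  refine inv_nonneg.mpr (Finset.prod_nonneg fun f _ => List.prod_nonneg fun x hx => ?_)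
  obtain ⟨z, -, rfl⟩ := List.mem_map.mp hx
  positivity

/-- `γ₅ D_W(U, m, 1)` is Hermitian in the fundamental representation (γ₅-hermiticity of the
Wilson–Dirac operator, tree theorem `wilsonDirac_gammaFive_hermitian_holds`; Lüscher (2.6)).
[cite: Luscher1994, §2 (2.6)] -/
theorem isHermitian_gammaFive_mul_wilsonDirac_fundamental {S : ℕ} [NeZero S]
    (U : GaugeConfig 4 S 𝔾) (m r : ℝ) :
    (spinorLift gammaFive * wilsonDirac (fundamentalRep (Fin 3)) U m r).IsHermitian := by
  have hρ : ∀ g : 𝔾, fundamentalRep (Fin 3) g ∈ Matrix.unitaryGroup (Fin 3) ℂ :=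
    fundamentalRep_mem_unitaryGroup
  have hconj := wilsonDirac_gammaFive_hermitian_holds (fundamentalRep (Fin 3)) hρ U m r
  have hsq := spinorLift_gammaFive_mul_self (L := S) (N := 3)
  have hΓ : (spinorLift (L := S) (N := 3) gammaFive)ᴴ = spinorLift gammaFive := by
    rw [spinorLift_gammaFive_eq_diagonal, Matrix.diagonal_conjTranspose]
    congr 1
    funext p
    obtain ⟨x, a, α⟩ := p
    fin_cases α <;> simp
  unfold Matrix.IsHermitian
  rw [Matrix.conjTranspose_mul, ← hconj, hΓ, Matrix.mul_assoc, Matrix.mul_assoc, hsq, Matrix.mul_one]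

/-- The product `∏_f ∏_{z ∈ l_f} |det(γ₅ D_W(U, m_f, 1) − z)|²` (the inverse weight `W⁻¹`) is
positive when no root is real: `γ₅ D_W` is Hermitian, so `det(γ₅ D_W − z) ≠ 0` for `Im z ≠ 0`.
[cite: Luscher1994, §3 (3.5)–(3.9)] -/
theorem multibosonWeight_inv_pos (S : ℕ) [NeZero S] (mq : Fin Nf → ℝ) {l : Fin Nf → List ℂ}
    (hl : ∀ f, ∀ z ∈ l f, z.im ≠ 0) (U : GaugeConfig 4 S 𝔾) :
    0 < ∏ f, ((l f).map fun z =>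
      ‖(spinorLift gammaFive * wilsonDirac (fundamentalRep (Fin 3)) U (mq f) 1 -
        z • 1).det‖ ^ 2).prod := by
  refine Finset.prod_pos fun f _ => List.prod_pos fun x hx => ?_
  obtain ⟨z, hz, rfl⟩ := List.mem_map.mp hx
  exact pow_pos (norm_pos_iff.mpr (det_sub_smul_one_ne_zero_of_isHermitian
    (isHermitian_gammaFive_mul_wilsonDirac_fundamental U (mq f) 1) (hl f z hz))) 2

/-- **`W > 0` for non-real roots**: if no root of any list `l_f` is real then `0 < W(U)` for EVERY
gauge field — the bosonised weight is a genuine positive weight (Lüscher §3: "none of the roots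
`z_k` … are real"). [cite: Luscher1994, §3 (3.5)–(3.9)] -/
theorem multibosonWeight_pos (S : ℕ) [NeZero S] (mq : Fin Nf → ℝ) {l : Fin Nf → List ℂ}
    (hl : ∀ f, ∀ z ∈ l f, z.im ≠ 0) (U : GaugeConfig 4 S 𝔾) : 0 < multibosonWeight S mq l U :=
  inv_pos.mpr (multibosonWeight_inv_pos S mq hl U)

/-- `U ↦ W(U)⁻¹ = ∏_f ∏_z |det(γ₅ D_W(U, m_f, 1) − z)|²` is continuous in the gauge field (a
polynomial in the link entries; `continuous_wilsonDirac`). [folklore] -/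
theorem continuous_multibosonWeight_inv (S : ℕ) [NeZero S] (mq : Fin Nf → ℝ) (l : Fin Nf → List ℂ) :
    Continuous fun U : GaugeConfig 4 S 𝔾 => ∏ f, ((l f).map fun z =>
      ‖(spinorLift gammaFive * wilsonDirac (fundamentalRep (Fin 3)) U (mq f) 1 -
        z • 1).det‖ ^ 2).prod := by
  refine continuous_finsetProd _ fun f _ => continuous_list_prod _ fun z _ => ?_
  exact (((continuous_const (y := (spinorLift gammaFive :
      Matrix (TorusSite 4 S × Fin 3 × Fin 4) (TorusSite 4 S × Fin 3 × Fin 4) ℂ))).matrix_mul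
    (continuous_wilsonDirac (fundamentalRep (Fin 3)) (continuous_fundamentalRep (Fin 3))
      (mq f) 1)).sub continuous_const).matrix_det.norm.pow 2

/-- `W` is measurable in the gauge field (no hypothesis on the roots: `x ↦ x⁻¹` is measurable on
`ℝ`). [folklore] -/
theorem measurable_multibosonWeight (S : ℕ) [NeZero S] (mq : Fin Nf → ℝ) (l : Fin Nf → List ℂ) :
    Measurable fun U : GaugeConfig 4 S 𝔾 => multibosonWeight S mq l U := by
  unfold multibosonWeight
  exact (continuous_multibosonWeight_inv S mq l).measurable.inv

/-- For non-real roots `W` is continuous in the gauge field. [folklore] -/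
theorem continuous_multibosonWeight (S : ℕ) [NeZero S] (mq : Fin Nf → ℝ) {l : Fin Nf → List ℂ}
    (hl : ∀ f, ∀ z ∈ l f, z.im ≠ 0) :
    Continuous fun U : GaugeConfig 4 S 𝔾 => multibosonWeight S mq l U := by
  unfold multibosonWeight
  exact (continuous_multibosonWeight_inv S mq l).inv₀ fun U =>
    (multibosonWeight_inv_pos S mq hl U).ne'

/-- For non-real roots `W` is integrable against every finite measure on the (compact) configuration
space, in particular against the Wilson measure. [folklore] -/
theorem integrable_multibosonWeight (S : ℕ) [NeZero S] (mq : Fin Nf → ℝ) {l : Fin Nf → List ℂ}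
    (hl : ∀ f, ∀ z ∈ l f, z.im ≠ 0) (μ : Measure (GaugeConfig 4 S 𝔾)) [IsFiniteMeasure μ] :
    Integrable (fun U => multibosonWeight S mq l U) μ := by
  obtain ⟨U₀, -, hU₀⟩ := (isCompact_univ (X := GaugeConfig 4 S 𝔾)).exists_isMaxOn
    Set.univ_nonempty (continuous_multibosonWeight S mq hl).continuousOn
  refine Integrable.of_bound (continuous_multibosonWeight S mq hl).measurable.aestronglyMeasurable
    (multibosonWeight S mq l U₀) (Eventually.of_forall fun U => ?_)
  rw [Real.norm_eq_abs, abs_of_nonneg (multibosonWeight_nonneg S mq l U)]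
  exact hU₀ (Set.mem_univ U)

/-- For non-real roots the normalisation `∫ W dμ_W` of the bosonised expectation is positive
(`W > 0` continuous, `μ_W` a probability measure). [folklore] -/
theorem integral_multibosonWeight_pos (S : ℕ) [NeZero S] (β : ℝ) (mq : Fin Nf → ℝ)
    {l : Fin Nf → List ℂ} (hl : ∀ f, ∀ z ∈ l f, z.im ≠ 0) :
    0 < ∫ U, multibosonWeight S mq l U
      ∂(wilsonMeasure (d := 4) (L := S) (fundamentalRep (Fin 3)) β) := by
  rw [integral_pos_iff_support_of_nonneg (fun U => multibosonWeight_nonneg S mq l U)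
    (integrable_multibosonWeight S mq hl _)]
  have hsupp : Function.support (fun U : GaugeConfig 4 S 𝔾 => multibosonWeight S mq l U) = Set.univ :=
    Set.eq_univ_of_forall fun U => (multibosonWeight_pos S mq hl U).ne'
  rw [hsupp, measure_univ]
  exact one_pos

/-- For non-real roots, `∫ W dμ_W ≠ 0` as a complex number (the denominator of
`multibosonExpect`). [folklore] -/
theorem integral_coe_multibosonWeight_ne_zero (S : ℕ) [NeZero S] (β : ℝ) (mq : Fin Nf → ℝ)
    {l : Fin Nf → List ℂ} (hl : ∀ f, ∀ z ∈ l f, z.im ≠ 0) :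
    ∫ U, (multibosonWeight S mq l U : ℂ)
      ∂(wilsonMeasure (d := 4) (L := S) (fundamentalRep (Fin 3)) β) ≠ 0 := by
  have hW : ∫ U, (multibosonWeight S mq l U : ℂ)
      ∂(wilsonMeasure (d := 4) (L := S) (fundamentalRep (Fin 3)) β) =
      ((∫ U, multibosonWeight S mq l U
        ∂(wilsonMeasure (d := 4) (L := S) (fundamentalRep (Fin 3)) β) : ℝ) : ℂ) :=
    integral_ofReal
  rw [hW]
  exact Complex.ofReal_ne_zero.mpr (integral_multibosonWeight_pos S β mq hl).ne'

/-- **The bosonised gauge-marginal expectation `E^bos`** on the torus of side `S` at inverse bare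
coupling `β` (tree normalisation of `wilsonMeasure`), bare masses `m_f` and root lists `l_f`:
`E^bos[g] = ∫ W g dμ_W / ∫ W dμ_W`, `μ_W = wilsonMeasure (fundamentalRep (Fin 3)) β` the `SU(3)`
Wilson measure and `W = multibosonWeight` — the gauge marginal of Lüscher's local bosonic theory
`Z_b⁻¹ ∫ D[U]D[φ]D[φ†] e^{−S_b[U,φ]}` after the Gaussian `φ`-integration ((3.8)–(3.9)); VERBATIM the
`let E` of route items `MultibosonLatticeGap` / `GapTransfer`. Bochner integrals: junk value `0` for
non-integrable integrands and `x/0 = 0` when the normalisation vanishes.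
[cite: Luscher1994, §3 (3.8)–(3.9)] -/
def multibosonExpect (S : ℕ) [NeZero S] (β : ℝ) (mq : Fin Nf → ℝ) (l : Fin Nf → List ℂ)
    (g : GaugeConfig 4 S 𝔾 → ℂ) : ℂ :=
  (∫ U, (multibosonWeight S mq l U : ℂ) * g U
      ∂(wilsonMeasure (d := 4) (L := S) (fundamentalRep (Fin 3)) β)) /
    ∫ U, (multibosonWeight S mq l U : ℂ) ∂(wilsonMeasure (d := 4) (L := S) (fundamentalRep (Fin 3)) β)

/-- `E^bos` is an average with a non-negative weight: `‖g‖ ≤ 1` pointwise implies `‖E^bos[g]‖ ≤ 1`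
— unconditionally (if `∫ W = 0`, in particular if `W` fails to be integrable, the junk value is
`0`). [folklore] -/
theorem norm_multibosonExpect_le_one (S : ℕ) [NeZero S] (β : ℝ) (mq : Fin Nf → ℝ)
    (l : Fin Nf → List ℂ) {g : GaugeConfig 4 S 𝔾 → ℂ} (hg : ∀ U, ‖g U‖ ≤ 1) :
    ‖multibosonExpect S β mq l g‖ ≤ 1 := by
  unfold multibosonExpect
  set μ := wilsonMeasure (d := 4) (L := S) (fundamentalRep (Fin 3)) β with hμ
  rw [norm_div]
  by_cases hI : ∫ U, (multibosonWeight S mq l U : ℂ) ∂μ = 0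
  · rw [hI, norm_zero, div_zero]; exact zero_le_one
  have hint : Integrable (fun U => (multibosonWeight S mq l U : ℂ)) μ := by
    by_contra h; exact hI (integral_undef h)
  have hW : ∫ U, (multibosonWeight S mq l U : ℂ) ∂μ = ((∫ U, multibosonWeight S mq l U ∂μ : ℝ) : ℂ) :=
    integral_ofReal
  have hnorm : ‖∫ U, (multibosonWeight S mq l U : ℂ) ∂μ‖ = ∫ U, multibosonWeight S mq l U ∂μ := by
    rw [hW, Complex.norm_real, Real.norm_eq_abs,
      abs_of_nonneg (integral_nonneg fun U => multibosonWeight_nonneg S mq l U)]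
  refine div_le_one_of_le₀ ?_ (norm_nonneg _)
  calc ‖∫ U, (multibosonWeight S mq l U : ℂ) * g U ∂μ‖
      ≤ ∫ U, ‖(multibosonWeight S mq l U : ℂ) * g U‖ ∂μ := norm_integral_le_integral_norm _
    _ ≤ ∫ U, ‖(multibosonWeight S mq l U : ℂ)‖ ∂μ := by
        refine integral_mono_of_nonneg (ae_of_all _ fun U => norm_nonneg _) hint.norm
          (ae_of_all _ fun U => ?_)
        dsimp only
        rw [norm_mul]
        exact mul_le_of_le_one_right (norm_nonneg _) (hg U)
    _ = ‖∫ U, (multibosonWeight S mq l U : ℂ) ∂μ‖ := by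
        rw [hnorm]
        refine integral_congr_ae (ae_of_all _ fun U => ?_)
        simp only [Complex.norm_real, Real.norm_eq_abs,
          abs_of_nonneg (multibosonWeight_nonneg S mq l U)]

/-- `E^bos[1] = 1` as soon as the normalisation `∫ W dμ_W` is non-zero (e.g. non-real roots and a
measurable weight on the probability measure `μ_W`). [folklore] -/
theorem multibosonExpect_const_one (S : ℕ) [NeZero S] (β : ℝ) (mq : Fin Nf → ℝ)
    (l : Fin Nf → List ℂ)
    (h : ∫ U, (multibosonWeight S mq l U : ℂ)
      ∂(wilsonMeasure (d := 4) (L := S) (fundamentalRep (Fin 3)) β) ≠ 0) :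
    multibosonExpect S β mq l (fun _ => 1) = 1 := by
  unfold multibosonExpect
  simp only [mul_one]
  exact div_self h

/-- **`E^bos[1] = 1` for non-real roots** (the bosonised expectation is an honest normalised
average). [cite: Luscher1994, §3 (3.9)] -/
theorem multibosonExpect_one (S : ℕ) [NeZero S] (β : ℝ) (mq : Fin Nf → ℝ) {l : Fin Nf → List ℂ}
    (hl : ∀ f, ∀ z ∈ l f, z.im ≠ 0) : multibosonExpect S β mq l (fun _ => 1) = 1 :=
  multibosonExpect_const_one S β mq l (integral_coe_multibosonWeight_ne_zero S β mq hl)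

/-! ### Root lists: the filter `q_l(t) = ∏_{z ∈ l} |t − z|²` and box-supported quasi-modes -/

/-- `q_l(t) = ∏_{z ∈ l} |t − z|²` for a finite root list `l ⊂ ℂ` and real `t`: on the Hermitian
operator `H = γ₅ D_W` the multiboson weight of one flavour is `∏_z |det(H − z)|⁻² = ∏ᵢ q_l(λᵢ)⁻¹`
over the real eigenvalues `λᵢ`, and admissibility asks `|t| q_l(t) ≈ 1` off a spectral gap
(Lüscher's `P(s) ≈ 1/s`, (3.2), here for `1/|t|` on two intervals). VERBATIM the `let qv` of the
route items. [cite: Luscher1994, §3 (3.1)–(3.5)] -/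
def multibosonModSq (l : List ℂ) (t : ℝ) : ℝ :=
  (l.map fun z => ‖(t : ℂ) - z‖ ^ 2).prod

/-- `q_[] = 1` (no roots). [folklore] -/
@[simp] theorem multibosonModSq_nil (t : ℝ) : multibosonModSq [] t = 1 := by
  simp [multibosonModSq]

/-- `q_{z :: l}(t) = |t − z|² q_l(t)`. [folklore] -/
@[simp] theorem multibosonModSq_cons (z : ℂ) (l : List ℂ) (t : ℝ) :
    multibosonModSq (z :: l) t = ‖(t : ℂ) - z‖ ^ 2 * multibosonModSq l t := by
  simp [multibosonModSq]

/-- `q_l(t) ≥ 0`. [folklore] -/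
theorem multibosonModSq_nonneg (l : List ℂ) (t : ℝ) : 0 ≤ multibosonModSq l t := by
  unfold multibosonModSq
  refine List.prod_nonneg fun x hx => ?_
  obtain ⟨z, -, rfl⟩ := List.mem_map.mp hx
  positivity

/-- **A box-supported real quasi-mode of the Wilson–Dirac operator** (the `let Qm` of the route
items): the gauge field `U` on the torus of side `S` carries, at bare mass `μ` and accuracy `η`, a
quark-index vector `v ≠ 0` supported inside the index set `P` (`v i = 0` off `P`) and a REAL
quasi-eigenvalue `t ≤ 0` with `‖(D_W(U, μ, 1) − t) v‖² ≤ η ‖v‖²` — near-zero modes of `γ₅ D_W` and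
sign defects (real modes `≤ 0` of `D_W`) "as one dilute gas" (route `MultibosonBridge`; the exact
real modes are the `HasLocalisedRealMode` of `SpectralDefectDensity`). [folklore] -/
def HasSupportedQuasiMode {S : ℕ} [NeZero S] (U : GaugeConfig 4 S 𝔾) (μ η : ℝ)
    (P : TorusSite 4 S × Fin 3 × Fin 4 → Prop) : Prop :=
  ∃ v : TorusSite 4 S × Fin 3 × Fin 4 → ℂ, v ≠ 0 ∧ (∀ i, ¬ P i → v i = 0) ∧ ∃ t : ℝ, t ≤ 0 ∧
    ∑ i, ‖((wilsonDirac (fundamentalRep (Fin 3)) U μ 1 - (t : ℂ) • 1).mulVec v) i‖ ^ 2 ≤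
      η * ∑ i, ‖v i‖ ^ 2

/-- Monotonicity of `HasSupportedQuasiMode` in the accuracy `η` and the support `P`. [folklore] -/
theorem HasSupportedQuasiMode.mono {S : ℕ} [NeZero S] {U : GaugeConfig 4 S 𝔾} {μ η η' : ℝ}
    {P P' : TorusSite 4 S × Fin 3 × Fin 4 → Prop} (h : HasSupportedQuasiMode U μ η P)
    (hη : η ≤ η') (hP : ∀ i, P i → P' i) : HasSupportedQuasiMode U μ η' P' := by
  obtain ⟨v, hv, hsupp, t, ht, hres⟩ := h
  refine ⟨v, hv, fun i hi => hsupp i fun hPi => hi (hP i hPi), t, ht, hres.trans ?_⟩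
  exact mul_le_mul_of_nonneg_right hη (Finset.sum_nonneg fun i _ => by positivity)

/-! ### Admissible multiboson data and spectral-tail domination along a scheme -/

/-- **Admissible multiboson data along a lattice QCD scheme** (the `let Adm` of route items
`MultibosonLatticeGap` / `GapTransfer`, VERBATIM): for `sch : QCDScheme N_f`, accuracies `ε_k`,
tolerances `δ_k`, locality scales `ℓ_k ∈ ℕ` and root lists `ν_{k,f}`, writing
`q(t) = multibosonModSq (ν k f) t = ∏_{z ∈ ν_{k,f}} |t − z|²` and `c = |m_f(k) + 4| + 4` (a bound for
`‖D_W(m_f(k))‖`, cf. Lüscher (2.7) `‖γ₅(D+m)‖ ≤ 8 + m`): the physical locality scale `a_k ℓ_k` is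
bounded; `δ_k → 0`; and for every `(k, f)`: `0 < ε_k`, `0 < δ_k < 1`, `ε_k ℓ_k² ≥ 64`, all roots are
non-real, `|t| q(t) ∈ [1 − δ_k, 1 + δ_k]` for `√ε_k c ≤ |t| ≤ c` (accuracy off the gap),
`|t| q(t) ≤ 1 + δ_k` for `|t| ≤ √ε_k c` (gap bound), and a Chebyshev LOCALITY CERTIFICATE:
`t q(t) = Σ_{j ≤ D} b_j T_j(t/c)` on `[−c, c]` with tails `Σ_{d ≤ j ≤ D} |b_j| ≤ δ_k⁻⁸ e^{−d/ℓ_k}`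
(Lüscher §4.3: Chebyshev approximation of `1/s` with a gap `ε`; here for `1/|t|` on two intervals).
A predicate (hypothesis structure of the route), not an assertion; its satisfiability along a
scheme is route item `AdmissibleRootsExist`. [cite: Luscher1994, §4.3 (4.11)–(4.17)] -/
def IsAdmissibleMultibosonData (sch : QCDScheme Nf) (ε δ : ℕ → ℝ) (ℓ : ℕ → ℕ)
    (ν : ℕ → Fin Nf → List ℂ) : Prop :=
  (∃ ρ : ℝ, ∀ k, sch.a k * ℓ k ≤ ρ) ∧ Tendsto δ atTop (𝓝 0) ∧
    ∀ (k : ℕ) (f : Fin Nf), 0 < ε k ∧ 0 < δ k ∧ δ k < 1 ∧ 64 ≤ ε k * (ℓ k : ℝ) ^ 2 ∧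
      (∀ z ∈ ν k f, z.im ≠ 0) ∧
      (∀ t : ℝ, Real.sqrt (ε k) * (|sch.mq f k + 4| + 4) ≤ |t| → |t| ≤ (|sch.mq f k + 4| + 4) →
        |t| * multibosonModSq (ν k f) t - 1 ≤ δ k ∧ 1 - |t| * multibosonModSq (ν k f) t ≤ δ k) ∧
      (∀ t : ℝ, |t| ≤ Real.sqrt (ε k) * (|sch.mq f k + 4| + 4) →
        |t| * multibosonModSq (ν k f) t ≤ 1 + δ k) ∧
      ∃ (D : ℕ) (b : ℕ → ℝ),
        (∀ t : ℝ, |t| ≤ (|sch.mq f k + 4| + 4) →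
          t * multibosonModSq (ν k f) t = ∑ j ∈ Finset.range (D + 1),
            b j * (Polynomial.Chebyshev.T ℝ (j : ℤ)).eval (t / (|sch.mq f k + 4| + 4))) ∧
        ∀ d : ℕ, (∑ j ∈ Finset.range (D + 1), if d ≤ j then |b j| else 0) ≤
          (δ k)⁻¹ ^ 8 * Real.exp (-((d : ℝ) / ℓ k))

/-- **Spectral-tail domination under the bosonised measure** (the `let Tail` of route items
`MultibosonLatticeGap` / `GapTransfer`, VERBATIM): `p_k ≥ 0`, `p_k → 0`, and eventually in `k`, on
every torus of side `2S+1 ≥ 2L_k+1` and for every family `B ⊂ [−S, S]⁴ ⊂ ℤ⁴` of box centres that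
is pairwise torus-`4ℓ_k`-separated (`∃ j, 4ℓ_k < |x_j − y_j| ∧ |x_j − y_j| + 4ℓ_k < 2S+1`), the
bosonised probability (`multibosonExpect` of the indicator) that EVERY `x ∈ B` carries, for some
flavour `f`, a quasi-mode of `D_W(U, m_f(k), 1)` supported in the `ℓ_k`-box around `x` (torus
projection) with real quasi-eigenvalue `t ≤ 0` at accuracy `4 ε_k c²`, `c = |m_f(k)+4|+4`
(`HasSupportedQuasiMode`), has real part `≤ p_k^{|B|}` — near-zero modes of `γ₅ D_W` and sign
defects as ONE dilute gas (route `MultibosonBridge`; quenched evidence for the rarity of small real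
modes towards the continuum: Edwards–Heller–Narayanan 1999). A predicate, not an assertion.
[cite: EdwardsHellerNarayanan1999, §4 and §6] -/
def HasSpectralTailDomination (sch : QCDScheme Nf) (ε p : ℕ → ℝ) (ℓ : ℕ → ℕ)
    (ν : ℕ → Fin Nf → List ℂ) : Prop :=
  (∀ k, 0 ≤ p k) ∧ Tendsto p atTop (𝓝 0) ∧
    ∀ᶠ k in atTop, ∀ S : ℕ, sch.L k ≤ S → ∀ B : Finset (Fin 4 → ℤ),
      (∀ x ∈ B, ∀ j, |x j| ≤ (S : ℤ)) →
      (∀ x ∈ B, ∀ y ∈ B, x ≠ y → ∃ j, (4 * ℓ k : ℤ) < |x j - y j| ∧ |x j - y j| + 4 * ℓ k < 2 * S + 1) →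
      (multibosonExpect (2 * S + 1) (sch.β k) (fun f => sch.mq f k) (ν k)
        ({U | ∀ x ∈ B, ∃ f, HasSupportedQuasiMode U (sch.mq f k)
            (4 * ε k * (|sch.mq f k + 4| + 4) ^ 2)
            (fun i => ∃ y : Fin 4 → ℤ, Torus.proj (2 * S + 1) y = i.1 ∧ ∀ j, |y j - x j| ≤ ℓ k)}.indicator
          1)).re ≤ p k ^ B.card

/-! ### The bosonised lattice gap -/

/-- **Uniform lattice gap `Δ` of the bosonised gauge marginal along the scheme, uniformly in the
volume** — the bosonic twin of `QCDScheme.HasLatticeMassGap` (the `let Gap` of route items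
`MultibosonLatticeGap` / `GapTransfer`, VERBATIM with `E ↦ multibosonExpect`): for all pairs of
`k`-indexed families `A, A'` of gauge functionals on `ℤ⁴` and ranges `r_k` with bounded physical
range `a_k r_k ≤ ρ`, such that each `A_k`, `A'_k` is measurable, bounded by `1`, and a cylinder
functional of a finite edge set within radius `r_k` of the origin, there is `C` (depending on the
families) such that for all large `k`, on EVERY torus of side `2S+1 ≥ 2L_k+1` and for all Euclidean
times `t ≤ S`: `‖E[A_k(0) A'_k(t e₀)] − E[A_k(0)] E[A'_k(t e₀)]‖ ≤ C e^{−Δ a_k t}`, where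
`E = multibosonExpect (2S+1) (β_k) (m(k)) (ν_k)` and the placement of `O` at time `s` is
`O_k (configShift (−s e₀) (torusLift (2S+1) U))` (as in `QCDLatticeObservable.onTorus`). Covariances
of bounded cylinder functionals suffice (gauge averaging factorises across separated supports).
Jaffe–Witten §5: "uniform gap for finite-volume approximations". A predicate, not an assertion:
every scheme has it for `Δ ≤ 0` (`hasMultibosonLatticeGap_of_nonpos`); the route asserts `∃ Δ > 0`.
[cite: JaffeWitten2000, §1 and §5] [cite: Luscher1994, §3 (3.8)–(3.9)] -/
def QCDScheme.HasMultibosonLatticeGap (sch : QCDScheme Nf) (ν : ℕ → Fin Nf → List ℂ) (Δ : ℝ) :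
    Prop :=
  ∀ (A A' : ℕ → LGConfig 4 𝔾 → ℂ) (r : ℕ → ℕ), (∃ ρ : ℝ, ∀ k, sch.a k * r k ≤ ρ) →
    (∀ O ∈ [A, A'], ∀ k, Measurable (O k) ∧ (∀ U, ‖O k U‖ ≤ 1) ∧
      ∃ es : Finset (ZdEdge 4), IsCylinder (O k) es ∧ ∀ e ∈ es, ∀ j, |e.1 j| ≤ r k) →
    ∃ C : ℝ, ∀ᶠ k in atTop, ∀ S : ℕ, sch.L k ≤ S → ∀ t : ℕ, t ≤ S →
      let plc := fun (O : ℕ → LGConfig 4 𝔾 → ℂ) (s : ℕ) (U : GaugeConfig 4 (2 * S + 1) 𝔾) =>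
        O k (configShift (-(Pi.single 0 (s : ℤ) : Fin 4 → ℤ)) (torusLift (2 * S + 1) U))
      let Ek := multibosonExpect (2 * S + 1) (sch.β k) (fun f => sch.mq f k) (ν k)
      ‖Ek (fun U => plc A 0 U * plc A' t U) - Ek (plc A 0) * Ek (plc A' t)‖ ≤
        C * Real.exp (-(Δ * (sch.a k * t)))


namespace QCDScheme

/-- **Antitone in `Δ`**: a bosonised lattice gap `Δ` is also a gap `Δ' ≤ Δ` (same families, constant
`max C 0`, since `a_k t ≥ 0`). [folklore] -/
theorem HasMultibosonLatticeGap.anti {sch : QCDScheme Nf} {ν : ℕ → Fin Nf → List ℂ} {Δ Δ' : ℝ}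
    (h : sch.HasMultibosonLatticeGap ν Δ) (hΔ : Δ' ≤ Δ) : sch.HasMultibosonLatticeGap ν Δ' := by
  intro A A' r hr hO
  obtain ⟨C, hC⟩ := h A A' r hr hO
  refine ⟨max C 0, hC.mono fun k hk S hS t ht => ?_⟩
  have hk' := hk S hS t ht
  dsimp only at hk' ⊢
  refine hk'.trans ?_
  have hat : 0 ≤ sch.a k * t := mul_nonneg (sch.a_pos k).le (Nat.cast_nonneg t)
  have hexp : Real.exp (-(Δ * (sch.a k * t))) ≤ Real.exp (-(Δ' * (sch.a k * t))) :=
    Real.exp_le_exp.mpr (by nlinarith)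
  calc C * Real.exp (-(Δ * (sch.a k * t)))
      ≤ max C 0 * Real.exp (-(Δ * (sch.a k * t))) :=
        mul_le_mul_of_nonneg_right (le_max_left _ _) (Real.exp_pos _).le
    _ ≤ max C 0 * Real.exp (-(Δ' * (sch.a k * t))) :=
        mul_le_mul_of_nonneg_left hexp (le_max_right _ _)

/-- Covariances of an averaging functional are bounded by `2` on the unit ball: if `‖E g‖ ≤ 1`
whenever `‖g‖ ≤ 1` pointwise, then `‖E[g₁g₂] − E[g₁]E[g₂]‖ ≤ 2` for `‖g₁‖, ‖g₂‖ ≤ 1`. [folklore] -/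
theorem norm_covariance_le_two {X : Type*} {E : (X → ℂ) → ℂ}
    (hE : ∀ g : X → ℂ, (∀ U, ‖g U‖ ≤ 1) → ‖E g‖ ≤ 1) {g₁ g₂ : X → ℂ}
    (h₁ : ∀ U, ‖g₁ U‖ ≤ 1) (h₂ : ∀ U, ‖g₂ U‖ ≤ 1) :
    ‖E (fun U => g₁ U * g₂ U) - E g₁ * E g₂‖ ≤ 2 := by
  have h12 : ∀ U, ‖g₁ U * g₂ U‖ ≤ 1 := fun U => by
    rw [norm_mul]; exact mul_le_one₀ (h₁ U) (norm_nonneg _) (h₂ U)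
  calc ‖E (fun U => g₁ U * g₂ U) - E g₁ * E g₂‖
      ≤ ‖E (fun U => g₁ U * g₂ U)‖ + ‖E g₁ * E g₂‖ := norm_sub_le _ _
    _ ≤ 1 + 1 * 1 := by
        rw [norm_mul]
        exact add_le_add (hE _ h12) (mul_le_mul (hE _ h₁) (hE _ h₂) (norm_nonneg _) zero_le_one)
    _ = 2 := by norm_num

/-- **Non-vacuity / where the content is**: EVERY scheme and root data have the bosonised "gap"
`Δ ≤ 0`, with constant `C = 2`, because `E^bos` is an average with a non-negative weight
(`norm_multibosonExpect_le_one`) and the tested functionals are bounded by `1`; the route's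
assertion is `∃ Δ > 0`. [folklore] -/
theorem hasMultibosonLatticeGap_of_nonpos (sch : QCDScheme Nf) (ν : ℕ → Fin Nf → List ℂ)
    {Δ : ℝ} (hΔ : Δ ≤ 0) : sch.HasMultibosonLatticeGap ν Δ := by
  intro A A' r _ hO
  have hA : ∀ k U, ‖A k U‖ ≤ 1 := fun k => ((hO A (by simp)) k).2.1
  have hA' : ∀ k U, ‖A' k U‖ ≤ 1 := fun k => ((hO A' (by simp)) k).2.1
  refine ⟨2, Eventually.of_forall fun k S _ t _ => ?_⟩
  dsimp only
  refine (norm_covariance_le_two (fun g hg => norm_multibosonExpect_le_one _ _ _ _ hg)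
    (fun U => hA k _) (fun U => hA' k _)).trans ?_
  have hat : 0 ≤ sch.a k * t := mul_nonneg (sch.a_pos k).le (Nat.cast_nonneg t)
  have hexp : (1 : ℝ) ≤ Real.exp (-(Δ * (sch.a k * t))) := Real.one_le_exp (by nlinarith)
  nlinarith

/-- **Stability under subsequences of the scheme** (a tail property, cf. route item
`DiagonalSpine.SubsequenceStability`): if `sch'` is `sch` restricted along a strictly increasing
`φ` (field equations for `a, β, L, m_f`), then a bosonised gap `Δ` for `(sch, ν)` is one for
`(sch', ν ∘ φ)`. Proof: extend the `j`-indexed test families by `0` off the range of `φ`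
(`Function.extend`), apply the hypothesis, and pull the eventual bound back along `φ → ∞`.
[folklore] -/
theorem HasMultibosonLatticeGap.comp_strictMono {sch sch' : QCDScheme Nf}
    {ν : ℕ → Fin Nf → List ℂ} {Δ : ℝ} (h : sch.HasMultibosonLatticeGap ν Δ) {φ : ℕ → ℕ}
    (hφ : StrictMono φ) (ha : ∀ j, sch'.a j = sch.a (φ j)) (hβ : ∀ j, sch'.β j = sch.β (φ j))
    (hL : ∀ j, sch'.L j = sch.L (φ j)) (hmq : ∀ f j, sch'.mq f j = sch.mq f (φ j)) :
    sch'.HasMultibosonLatticeGap (ν ∘ φ) Δ := by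
  intro B B' r hr hO
  have hinj := hφ.injective
  -- the `k`-indexed extensions (zero / range zero off the range of `φ`)
  let e0 : ℕ → LGConfig 4 𝔾 → ℂ := fun _ _ => 0
  let r' : ℕ → ℕ := Function.extend φ r fun _ => 0
  have hr' : ∀ j, r' (φ j) = r j := fun j => hinj.extend_apply _ _ j
  have hr'0 : ∀ k, (¬ ∃ j, φ j = k) → r' k = 0 := fun k hk => Function.extend_apply' _ _ k hk
  -- test-family hypotheses transfer to the extensions
  have key : ∀ O : ℕ → LGConfig 4 𝔾 → ℂ,
      (∀ k, Measurable (O k) ∧ (∀ U, ‖O k U‖ ≤ 1) ∧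
        ∃ es : Finset (ZdEdge 4), IsCylinder (O k) es ∧ ∀ e ∈ es, ∀ i, |e.1 i| ≤ r k) →
      ∀ k, Measurable (Function.extend φ O e0 k) ∧ (∀ U, ‖Function.extend φ O e0 k U‖ ≤ 1) ∧
        ∃ es : Finset (ZdEdge 4), IsCylinder (Function.extend φ O e0 k) es ∧
          ∀ e ∈ es, ∀ i, |e.1 i| ≤ r' k := by
    intro O hOk k
    by_cases hk : ∃ j, φ j = k
    · obtain ⟨j, rfl⟩ := hk
      rw [hinj.extend_apply, hr' j]
      exact hOk j
    · have h0 : Function.extend φ O e0 k = fun _ => 0 := Function.extend_apply' _ _ k hk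
      refine ⟨?_, ?_, ∅, ?_, ?_⟩
      · rw [h0]; exact measurable_const
      · intro U; rw [h0, norm_zero]; exact zero_le_one
      · rw [h0]; exact fun _ _ _ => rfl
      · intro e he; simp at he
  have hO' : ∀ O ∈ [Function.extend φ B e0, Function.extend φ B' e0], ∀ k,
      Measurable (O k) ∧ (∀ U, ‖O k U‖ ≤ 1) ∧
        ∃ es : Finset (ZdEdge 4), IsCylinder (O k) es ∧ ∀ e ∈ es, ∀ i, |e.1 i| ≤ r' k := by
    intro O hOm
    simp only [List.mem_cons, List.not_mem_nil, or_false] at hOm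
    rcases hOm with rfl | rfl
    · exact key B (hO B (by simp))
    · exact key B' (hO B' (by simp))
  obtain ⟨ρ, hρ⟩ := hr
  have hρ' : ∀ k, sch.a k * r' k ≤ max ρ 0 := by
    intro k
    by_cases hk : ∃ j, φ j = k
    · obtain ⟨j, rfl⟩ := hk
      rw [hr' j, ← ha j]
      exact (hρ j).trans (le_max_left _ _)
    · rw [hr'0 k hk, Nat.cast_zero, mul_zero]
      exact le_max_right _ _
  obtain ⟨C, hC⟩ := h (Function.extend φ B e0) (Function.extend φ B' e0) r' ⟨max ρ 0, hρ'⟩ hO'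
  refine ⟨C, (hφ.tendsto_atTop.eventually hC).mono fun j hj S hS t ht => ?_⟩
  have hS' : sch.L (φ j) ≤ S := by rw [← hL j]; exact hS
  have hj' := hj S hS' t ht
  dsimp only at hj' ⊢
  simp only [hinj.extend_apply] at hj'
  simpa only [ha, hβ, hmq, Function.comp_apply] using hj'

end QCDScheme

/-- **Admissibility is stable under subsequences** (a tail property): restricting the scheme's
`a, m_f` and the data `ε, δ, ℓ, ν` along a strictly increasing `φ` preserves
`IsAdmissibleMultibosonData`. [folklore] -/
theorem IsAdmissibleMultibosonData.comp_strictMono {sch sch' : QCDScheme Nf} {ε δ : ℕ → ℝ}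
    {ℓ : ℕ → ℕ} {ν : ℕ → Fin Nf → List ℂ} (h : IsAdmissibleMultibosonData sch ε δ ℓ ν)
    {φ : ℕ → ℕ} (hφ : StrictMono φ) (ha : ∀ j, sch'.a j = sch.a (φ j))
    (hmq : ∀ f j, sch'.mq f j = sch.mq f (φ j)) :
    IsAdmissibleMultibosonData sch' (ε ∘ φ) (δ ∘ φ) (ℓ ∘ φ) (ν ∘ φ) := by
  obtain ⟨⟨ρ, hρ⟩, hδ, hk⟩ := h
  refine ⟨⟨ρ, fun j => ?_⟩, hδ.comp hφ.tendsto_atTop, fun j f => ?_⟩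
  · rw [Function.comp_apply, ha]
    exact hρ (φ j)
  · simpa only [Function.comp_apply, hmq] using hk (φ j) f

/-- **Spectral-tail domination is stable under subsequences** (a tail property: `∀ᶠ` along
`atTop` pulls back along `φ → ∞`, `p ∘ φ → 0`). [folklore] -/
theorem HasSpectralTailDomination.comp_strictMono {sch sch' : QCDScheme Nf} {ε p : ℕ → ℝ}
    {ℓ : ℕ → ℕ} {ν : ℕ → Fin Nf → List ℂ} (h : HasSpectralTailDomination sch ε p ℓ ν)
    {φ : ℕ → ℕ} (hφ : StrictMono φ) (hβ : ∀ j, sch'.β j = sch.β (φ j))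
    (hL : ∀ j, sch'.L j = sch.L (φ j)) (hmq : ∀ f j, sch'.mq f j = sch.mq f (φ j)) :
    HasSpectralTailDomination sch' (ε ∘ φ) (p ∘ φ) (ℓ ∘ φ) (ν ∘ φ) := by
  obtain ⟨hp0, hp, hev⟩ := h
  refine ⟨fun j => hp0 (φ j), hp.comp hφ.tendsto_atTop, ?_⟩
  refine (hφ.tendsto_atTop.eventually hev).mono fun j hj => ?_
  simpa only [Function.comp_apply, hβ, hL, hmq] using hj


/-! ### The monic obstruction: why Lüscher's normalisation `κ` cannot be dropped -/

section MonicObstruction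

open Polynomial Finset

/-- The root weight `q_l(t) = ∏_{z ∈ l} |t − z|²` is the value at `t` of the real polynomial
`∏_{z ∈ l} ((X − Re z)² + (Im z)²)`. [folklore] -/
theorem eval_multibosonPoly (l : List ℂ) (t : ℝ) :
    ((l.map fun z : ℂ => (X - C z.re) ^ 2 + C (z.im ^ 2)).prod).eval t = multibosonModSq l t := by
  induction l with
  | nil => simp
  | cons z l ih =>
    have hz : ((X - C z.re) ^ 2 + C (z.im ^ 2) : ℝ[X]).eval t = ‖(t : ℂ) - z‖ ^ 2 := by
      rw [Complex.sq_norm, Complex.normSq_apply]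
      simp only [eval_add, eval_pow, eval_sub, eval_X, eval_C, Complex.sub_re, Complex.ofReal_re,
        Complex.sub_im, Complex.ofReal_im, zero_sub, mul_neg, neg_mul, neg_neg]
      ring
    simp only [List.map_cons, List.prod_cons, eval_mul, ih, multibosonModSq_cons]
    rw [hz]

/-- `∏_{z ∈ l} ((X − Re z)² + (Im z)²)` is monic of degree `2|l|`. [folklore] -/
theorem monic_multibosonPoly (l : List ℂ) :
    ((l.map fun z : ℂ => (X - C z.re) ^ 2 + C (z.im ^ 2)).prod).Monic ∧
      ((l.map fun z : ℂ => (X - C z.re) ^ 2 + C (z.im ^ 2)).prod).natDegree = 2 * l.length := by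
  induction l with
  | nil => simp
  | cons z l ih =>
    have hm : ((X - C z.re) ^ 2 + C (z.im ^ 2) : ℝ[X]).Monic := by
      monicity!
    have hd : ((X - C z.re) ^ 2 + C (z.im ^ 2) : ℝ[X]).natDegree = 2 := by
      compute_degree!
    simp only [List.map_cons, List.prod_cons, List.length_cons]
    refine ⟨hm.mul ih.1, ?_⟩
    rw [hm.natDegree_mul ih.1, hd, ih.2]
    ring

/-- Numerical kernel of the obstruction: `2 · 2.72^m ≤ 4^m` for `m ≥ 3`. [folklore] -/
private theorem two_mul_pow_le_four_pow (m : ℕ) (hm : 3 ≤ m) : 2 * (2.72 : ℝ) ^ m ≤ 4 ^ m := by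
  induction m, hm using Nat.le_induction with
  | base => norm_num
  | succ k hk ih =>
    rw [pow_succ, pow_succ]
    nlinarith [ih, pow_pos (by norm_num : (0:ℝ) < 2.72) k]

/-- **Monic obstruction** (why the rev-3 predicate dropped too much). No finite root list `l`
makes the MONIC `|t| · ∏_{z ∈ l} |t − z|²` stay below `1 + δ < 2` on `[−c, c]` when `c ≥ 4`:
`t · ∏ |t − z|²` is a monic real polynomial of degree `m = 2|l| + 1`, its `m`-th finite difference
with step `2c/m` over the nodes `−c, −c + 2c/m, …, c` equals `m! (2c/m)^m ≥ m! (8/m)^m > 2^{m+1}`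
for `m ≥ 3` (`m^m ≤ e^m m!`), while the node bound forces it below `Σₖ C(m,k)(1 + δ) < 2^{m+1}`;
the empty list fails at `t = c` (`c ≤ 1 + δ`). Background: Chebyshev — a monic polynomial of degree
`m` has sup norm `≥ 2 (c/2)^m` on `[−c, c]`; Lüscher's `P(s) ≈ 1/s` carries a free normalisation.
(Ported from the refutation `Summit.QuantumFields.QCD.Theorems.MultibosonBridgeMultibosonLatticeGap_refuted`
of the rev-3 crux, so that the Literature vocabulary documents its own degeneracy.) [folklore] -/
theorem multibosonModSq_monic_obstruction (l : List ℂ) {c δ : ℝ} (hc : 4 ≤ c) (hδ : δ < 1)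
    (h : ∀ t : ℝ, |t| ≤ c → |t| * multibosonModSq l t ≤ 1 + δ) : False := by
  by_cases hl : l = []
  · subst hl
    have := h c (by rw [abs_of_nonneg (by linarith)])
    simp [abs_of_nonneg (show (0:ℝ) ≤ c by linarith)] at this
    linarith
  -- non-empty list: the monic polynomial `p = X · ∏ ((X − re z)² + (im z)²)` of degree `m = 2n+1`
  set n := l.length with hn
  have hn1 : 1 ≤ n := List.length_pos_iff.mpr hl
  set m := 2 * n + 1 with hm
  have hm3 : 3 ≤ m := by omega
  have hmpos : (0 : ℝ) < m := by positivity
  set p : ℝ[X] := X * (l.map fun z : ℂ => (X - C z.re) ^ 2 + C (z.im ^ 2)).prod with hp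
  have hF := monic_multibosonPoly l
  have hpm : p.Monic := monic_X.mul hF.1
  have hpd : p.natDegree = m := by
    rw [hp, monic_X.natDegree_mul hF.1, natDegree_X, hF.2]; ring
  have hpe : ∀ t, p.eval t = t * multibosonModSq l t := by
    intro t; rw [hp, eval_mul, eval_X, eval_multibosonPoly]
  -- step size `s = 2c/m` and the rescaled polynomial `Q(x) = p(s x − c)`
  set s : ℝ := 2 * c / m with hs
  have hspos : 0 < s := by positivity
  set Q : ℝ[X] := p.comp (C s * X + C (-c)) with hQ
  have hlin : (C s * X + C (-c) : ℝ[X]).natDegree = 1 := natDegree_linear hspos.ne'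
  have hQd : Q.natDegree = m := by
    rw [hQ, natDegree_comp, hlin, hpd, mul_one]
  have hQl : Q.leadingCoeff = s ^ m := by
    rw [hQ, leadingCoeff_comp (by rw [hlin]; exact one_ne_zero), leadingCoeff_linear hspos.ne',
      hpm.leadingCoeff, one_mul, hpd]
  have hQe : ∀ x : ℝ, Q.eval x = (s * x - c) * multibosonModSq l (s * x - c) := by
    intro x
    rw [hQ, eval_comp]
    simp [hpe, sub_eq_add_neg]
  -- the finite-difference identity `Δ₁^m Q(0) = s^m · m!`
  have hfd := congrFun (Polynomial.fwdDiff_iter_degree_eq_factorial Q) 0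
  rw [hQd, hQl, fwdDiff_iter_eq_sum_shift] at hfd
  simp only [Pi.smul_apply, Pi.natCast_apply, smul_eq_mul, zero_add, nsmul_eq_mul, mul_one,
    zsmul_eq_mul, Int.cast_mul, Int.cast_pow, Int.cast_neg, Int.cast_one, Int.cast_natCast] at hfd
  -- bound the alternating sum by `2^m (1 + δ)` using the hypothesis at the nodes `s k − c ∈ [−c, c]`
  have hbound : ∀ k ∈ range (m + 1), |(-1 : ℝ) ^ (m - k) * (m.choose k : ℝ) * Q.eval (k : ℝ)|
      ≤ (m.choose k : ℝ) * (1 + δ) := by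
    intro k hk
    have hkm : (k : ℝ) ≤ m := by exact_mod_cast Nat.lt_succ_iff.mp (mem_range.mp hk)
    have hk0 : (0 : ℝ) ≤ k := by positivity
    have ht : |s * k - c| ≤ c := by
      rw [abs_le]
      constructor
      · nlinarith
      · have : s * k ≤ 2 * c := by
          rw [hs, div_mul_eq_mul_div, div_le_iff₀ hmpos]; nlinarith
        linarith
    have hq := h _ ht
    rw [abs_mul, abs_mul, abs_pow, abs_neg, abs_one, one_pow, one_mul, Nat.abs_cast, hQe, abs_mul]
    exact mul_le_mul_of_nonneg_left
      (by rwa [abs_of_nonneg (multibosonModSq_nonneg _ _)]) (by positivity)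
  have hsum : |∑ k ∈ range (m + 1), (-1 : ℝ) ^ (m - k) * (m.choose k : ℝ) * Q.eval (k : ℝ)|
      ≤ 2 ^ m * (1 + δ) := by
    calc _ ≤ ∑ k ∈ range (m + 1), |(-1 : ℝ) ^ (m - k) * (m.choose k : ℝ) * Q.eval (k : ℝ)| :=
          abs_sum_le_sum_abs _ _
      _ ≤ ∑ k ∈ range (m + 1), (m.choose k : ℝ) * (1 + δ) := sum_le_sum hbound
      _ = 2 ^ m * (1 + δ) := by
          rw [← sum_mul]; congr 1; exact_mod_cast Nat.sum_range_choose m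
  rw [hfd] at hsum
  rw [abs_of_nonneg (by positivity)] at hsum
  -- arithmetic: `8^m m! ≤ (2c)^m m! = s^m m! m^m ≤ 2^m (1+δ) m^m < 2^(m+1) e^m m! < 2^(m+1) 2.72^m m! ≤ 8^m m!`
  have hfact : (m : ℝ) ^ m ≤ Real.exp 1 ^ m * m.factorial := by
    have := Real.pow_div_factorial_le_exp (m : ℝ) (by positivity) m
    rw [div_le_iff₀ (by positivity)] at this
    rw [← Real.exp_one_pow] at this
    exact this
  have he : Real.exp 1 ^ m < (2.72 : ℝ) ^ m :=
    pow_lt_pow_left₀ (lt_trans Real.exp_one_lt_d9 (by norm_num)) (Real.exp_pos 1).le (by omega)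
  have hsm : s ^ m * (m : ℝ) ^ m = (2 * c) ^ m := by
    rw [← mul_pow, hs, div_mul_cancel₀ _ hmpos.ne']
  have h8 : (8 : ℝ) ^ m ≤ (2 * c) ^ m := pow_le_pow_left₀ (by norm_num) (by linarith) m
  have key := two_mul_pow_le_four_pow m hm3
  have hmf : (0 : ℝ) < m.factorial := by positivity
  have hA : (8 : ℝ) ^ m * m.factorial ≤ (s ^ m * m.factorial) * (m : ℝ) ^ m := by
    calc (8 : ℝ) ^ m * m.factorial ≤ (2 * c) ^ m * m.factorial :=
          mul_le_mul_of_nonneg_right h8 hmf.le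
      _ = (s ^ m * m.factorial) * (m : ℝ) ^ m := by rw [← hsm]; ring
  have hB : (s ^ m * m.factorial) * (m : ℝ) ^ m ≤ 2 ^ m * (1 + δ) * (m : ℝ) ^ m :=
    mul_le_mul_of_nonneg_right hsum (by positivity)
  have hC : 2 ^ m * (1 + δ) * (m : ℝ) ^ m < 2 ^ m * 2 * (m : ℝ) ^ m := by
    have : (0 : ℝ) < 2 ^ m * (m : ℝ) ^ m := by positivity
    nlinarith
  have hD : 2 ^ m * 2 * (m : ℝ) ^ m ≤ 2 ^ m * 2 * (Real.exp 1 ^ m * m.factorial) :=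
    mul_le_mul_of_nonneg_left hfact (by positivity)
  have hE : 2 ^ m * 2 * (Real.exp 1 ^ m * m.factorial) <
      2 ^ m * 2 * ((2.72 : ℝ) ^ m * m.factorial) := by
    apply mul_lt_mul_of_pos_left _ (by positivity)
    exact mul_lt_mul_of_pos_right he hmf
  have hF' : 2 ^ m * 2 * ((2.72 : ℝ) ^ m * m.factorial) ≤ 2 ^ m * 4 ^ m * m.factorial := by
    calc 2 ^ m * 2 * ((2.72 : ℝ) ^ m * m.factorial)
          = 2 ^ m * (2 * (2.72 : ℝ) ^ m) * m.factorial := by ring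
      _ ≤ 2 ^ m * 4 ^ m * m.factorial := by gcongr
  have hG : (2 : ℝ) ^ m * 4 ^ m * m.factorial = 8 ^ m * m.factorial := by rw [← mul_pow]; norm_num
  linarith [hA, hB, hC, hD, hE, hF', hG]

end MonicObstruction

/-- **The rev-3 predicate is unsatisfiable as soon as there is a flavour**: at `(k, f) = (0, f)`
its accuracy and gap clauses bound the monic `|t| · ∏_{z ∈ ν 0 f} |t − z|²` by `1 + δ_0 < 2` on
`[−c, c]`, `c = |m_f(0) + 4| + 4 ≥ 4`, contradicting `multibosonModSq_monic_obstruction`. This is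
why the route's later revisions use `IsAdmissibleMultibosonDataR` (`MultibosonAdmissibleData.lean`).
[folklore] -/
protected theorem IsAdmissibleMultibosonData.false {sch : QCDScheme Nf} {ε δ : ℕ → ℝ} {ℓ : ℕ → ℕ}
    {ν : ℕ → Fin Nf → List ℂ} (h : IsAdmissibleMultibosonData sch ε δ ℓ ν) (f : Fin Nf) : False := by
  obtain ⟨-, -, hk⟩ := h
  obtain ⟨-, -, hδ1, -, -, ha, hb, -⟩ := hk 0 f
  refine multibosonModSq_monic_obstruction (ν 0 f) (c := |sch.mq f 0 + 4| + 4)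
    (by linarith [abs_nonneg (sch.mq f 0 + 4)]) hδ1 fun t ht => ?_
  by_cases hlt : Real.sqrt (ε 0) * (|sch.mq f 0 + 4| + 4) ≤ |t|
  · have := (ha t hlt ht).1
    linarith
  · exact hb t (le_of_lt (not_le.mp hlt))

/-- **`¬ IsAdmissibleMultibosonData` for `N_f ≥ 1`**: the rev-3 predicate is EMPTY whenever a
flavour exists, hence superseded by `IsAdmissibleMultibosonDataR` (`MultibosonAdmissibleData.lean`).
[folklore] -/
theorem not_isAdmissibleMultibosonData [Nonempty (Fin Nf)] (sch : QCDScheme Nf) (ε δ : ℕ → ℝ)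
    (ℓ : ℕ → ℕ) (ν : ℕ → Fin Nf → List ℂ) : ¬ IsAdmissibleMultibosonData sch ε δ ℓ ν :=
  fun h => (‹Nonempty (Fin Nf)›).elim fun f => h.false f

end Literature.MathematicalPhysics.QuantumFieldTheory

end
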